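import Summits.CriticalPhenomena.CardyFormulaZ2.Theorems.CardyMagicRigidityNestingRigidityUVCollarPoisson
import Summits.CriticalPhenomena.CardyFormulaZ2.Theorems.CardyMagicRigidityNestingRigidityUVCollarCells
import Summits.CriticalPhenomena.CardyFormulaZ2.Theorems.CardyMagicRigidityNestingRigidityTowerMomentUpperZ2
import HarnessLib

/-!
# Crux `NestingRigidity`, line `positive-cone-weight-doubling`: ASPECT-DEPENDENT exponential
# moments of the number of loops crossing a thin collar, bond-`ℤ²` (collar statistic, helper K
# `uvCollar_expMoment_latticeEnsembles`)

Crux `Summit.CriticalPhenomena.CardyFormulaZ2.Theses.CardyMagicRigidity.NestingRigidity`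
(stmt-CriticalPhenomena-4835), line `positive-cone-weight-doubling`, registered helper K
`uvCollar_expMoment_latticeEnsembles`.  The missing RSW tool of the collar estimate: crossing-count
tails whose RATE IMPROVES WITH THE ASPECT RATIO, jointly over all the cells of a collar (K2
`LoopCrossCount.measureReal_le_ncard_cross_zEns` is fixed-aspect).  This file proves the bond-`ℤ²`
half (anchor `expMoment_collarCount_le_zEns`): there are `α, c₀ > 0` (`c₀ ≥ 4`) such that for every
aspect ratio `K ≥ 8`, mesh `δ > 0`, radius `ρ > 0`, cell size `a ≥ c₀ δ`, order `λ ≥ 0` with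
`e^{2λ} (4/K)^α ≤ 1/2`, and every family `Q` of loops each of which (i) passes through the thin
collar `ρ − a/2 ≤ |z| ≤ ρ` and (ii) is not drawn inside any ball `B(x, K a)` centred on the circle
`|x| = ρ` (big crossers: `diam > 2Ka`; exit loops: they surround `0` and `K a ≤ ρ`),
`E_δ exp(λ #{u ∈ X_δ : Q u}) ≤ exp(2 (e^{2λ} − 1) (4/K)^α (4πρ/a + 3))` — POISSONIAN in the
`≤ 4πρ/a + 3` cells of the collar (`UVCollar.exists_circle_cells`) with cell intensity `(4/K)^α`.
Proof: the loops of `Q` sort into the cells (`UVCollar.exists_families_of_cells`), the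
counter-clockwise ones put `ω` in the joint disjoint occurrence of `g i` open crossings of the cell
annuli `A(c i; a + δ, K a − δ)` for EVERY `g ≤` occupation pattern
(`BigLoopsExp.mem_foldr_of_typeOne_families`), the clockwise ones do the same for `dualConfig ω`
(`…_dualConfig_of_typeZero_families`); one BK–Reimer product (`TowerMomentUpper.pattern_bound_zEns`),
RSW at aspect `K` (`TowerMomentUpper.crossing_le_zEns`), self-duality, and the Poissonian summation
`UVCollar.integral_exp_le_of_poissonTails` (`…UVCollarPoisson`).  No cited fact, no definition.
-/

noncomputable section

open MeasureTheory Set Filter Metric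
open scoped Real Topology BigOperators ENNReal

namespace Summit.CriticalPhenomena.CardyFormulaZ2.Cruxes.NestingRigidity.PositiveConeWeightDoubling

open Literature.Probability.RandomPlanarGeometry Literature.Probability.Percolation
  Literature.Probability.LatticeModels
open Summit.CriticalPhenomena.CardyFormulaZ2.Cruxes.NestingRigidity.RingCloudTomography

namespace UVCollar

/-! ## §1 Pointwise: the occupation patterns of a family of collar loops (bond-`ℤ²`) -/

/-- **The occupation patterns of a family of collar loops on bond-`ℤ²`.**  For a lattice
configuration `ω` at mesh `δ > 0`, cells centred on the circle `|x| = ρ` within `a/2` of every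
point of it, `a + 2δ ≤ K a`, and a family `Q` of loops passing through the collar
`ρ − a/2 ≤ |z| ≤ ρ` and not inside any `B(x, K a)`, `|x| = ρ`: there are patterns
`m₀, m₁ : Fin B → Fin (M+1)` with `#{u ∈ X_δ : Q u} ≤ Σ m₀ + Σ m₁`, `dualConfig ω` in the joint
disjoint occurrence of `g i` open crossings of the annuli about `c i − δ(1+i)/2` for every
`g ≤ m₀`, and `ω` in that of `g i` open crossings of `A(c i; a + δ, K a − δ)` for every `g ≤ m₁`. -/
theorem exists_collarPatterns_zEns {ω : BondConfig (Site 2)} (hω : ω ⊆ (zdGraph 2).edgeSet)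
    {δ : ℝ} (hδ : 0 < δ) {ρ a K : ℝ} (hρ : 0 < ρ) (hab : a + 2 * δ ≤ K * a) {M : ℕ}
    (hM : {u ∈ (zEns.X δ ω).loops | (u.range ∩ closedBall (0 : ℂ) ρ).Nonempty}.Finite ∧
      {u ∈ (zEns.X δ ω).loops | (u.range ∩ closedBall (0 : ℂ) ρ).Nonempty}.ncard ≤ M)
    {B : ℕ} {c : Fin B → ℂ} (hcn : ∀ i, ‖c i‖ = ρ)
    (hc : ∀ w : ℂ, ‖w‖ = ρ → ∃ i, dist w (c i) ≤ a / 2) (Q : UnbasedLoop ℂ → Prop)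
    (hQ : ∀ u, Q u → (∃ z ∈ u.range, ρ - a / 2 ≤ ‖z‖ ∧ ‖z‖ ≤ ρ) ∧
      ∀ x : ℂ, ‖x‖ = ρ → (u.range ∩ (ball x (K * a))ᶜ).Nonempty) :
    ∃ m₀ m₁ : Fin B → Fin (M + 1),
      {u ∈ (zEns.X δ ω).loops | Q u}.ncard ≤ ∑ i, (m₁ i : ℕ) + ∑ i, (m₀ i : ℕ) ∧
      (∀ g : Fin B → ℕ, (∀ i, g i ≤ m₁ i) → ω ∈ (List.ofFn fun i ↦ disjointOccurrencePow
        (annulusOpenCrossing (c i) δ (a + δ) (K * a - δ)) (g i)).foldr disjointOccurrence univ) ∧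
      (∀ g : Fin B → ℕ, (∀ i, g i ≤ m₀ i) → dualConfig ω ∈ (List.ofFn fun i ↦ disjointOccurrencePow
        (annulusOpenCrossing (c i - δ * (1 + Complex.I) / 2) δ (a + δ) (K * a - δ)) (g i)).foldr
          disjointOccurrence univ) := by
  -- the typed families
  set S : Fin 2 → Set (UnbasedLoop ℂ) := fun t ↦ {u ∈ (bondLoopConfig δ 0 ω).F t | Q u} with hS
  have hSsub : ∀ t, S t ⊆ {u ∈ (zEns.X δ ω).loops | (u.range ∩ closedBall (0 : ℂ) ρ).Nonempty} := by
    rintro t u ⟨hu, hq⟩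
    refine ⟨?_, ?_⟩
    · change u ∈ (bondLoopConfig δ 0 ω).loops
      rw [LoopConfig.mem_loops_iff]
      fin_cases t
      · exact Or.inl hu
      · exact Or.inr hu
    · obtain ⟨z, hz, -, hz2⟩ := (hQ u hq).1
      exact ⟨z, hz, mem_closedBall_zero_iff.2 hz2⟩
  have hSfin : ∀ t, (S t).Finite := fun t ↦ hM.1.subset (hSsub t)
  have hSM : ∀ t, (S t).ncard ≤ M := fun t ↦ (Set.ncard_le_ncard (hSsub t) hM.1).trans hM.2
  have hcell : ∀ t, ∀ u ∈ S t, ∃ i, (u.range ∩ closedBall (c i) a).Nonempty ∧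
      (u.range ∩ (ball (c i) (K * a))ᶜ).Nonempty := by
    rintro t u ⟨-, hq⟩
    obtain ⟨⟨z, hz, hz1, hz2⟩, hfar⟩ := hQ u hq
    obtain ⟨i, hi⟩ := exists_cell_of_collar hρ hc hz1 hz2
    exact ⟨i, ⟨z, hz, mem_closedBall.2 hi⟩, hfar (c i) (hcn i)⟩
  -- the count splits by type
  have hcount : {u ∈ (zEns.X δ ω).loops | Q u}.ncard ≤ (S 0).ncard + (S 1).ncard := by
    have heq : {u ∈ (zEns.X δ ω).loops | Q u} = S 0 ∪ S 1 := by
      ext u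
      simp only [hS, Set.mem_setOf_eq, Set.mem_union]
      change (u ∈ (bondLoopConfig δ 0 ω).loops ∧ _) ↔ _
      rw [LoopConfig.mem_loops_iff]
      tauto
    rw [heq]
    exact Set.ncard_union_le _ _
  -- sort both typed families into the cells
  obtain ⟨T₀, m₀, hT₀S, hT₀fin, hT₀disj, hmeet₀, hm₀, hsum₀⟩ :=
    exists_families_of_cells (hSfin 0) (hSM 0) c (fun _ ↦ a) (fun _ ↦ K * a) (hcell 0)
  obtain ⟨T₁, m₁, hT₁S, hT₁fin, hT₁disj, hmeet₁, hm₁, hsum₁⟩ :=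
    exists_families_of_cells (hSfin 1) (hSM 1) c (fun _ ↦ a) (fun _ ↦ K * a) (hcell 1)
  refine ⟨m₀, m₁, ?_, fun g hg ↦ ?_, fun g hg ↦ ?_⟩
  · rw [hsum₀, hsum₁, add_comm]; exact hcount
  · exact BigLoopsExp.mem_foldr_of_typeOne_families hω hδ (a := fun _ ↦ a) (b := fun _ ↦ K * a)
      (fun _ ↦ hab) c T₁ (fun i u hu ↦ (hT₁S i hu).1) hT₁fin hT₁disj hmeet₁ g
      fun i ↦ (hg i).trans (hm₁ i).le
  · exact BigLoopsExp.mem_foldr_dualConfig_of_typeZero_families hω hδ (a := fun _ ↦ a)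
      (b := fun _ ↦ K * a) (fun _ ↦ hab) c T₀ (fun i u hu ↦ (hT₀S i hu).1) hT₀fin hT₀disj hmeet₀ g
      fun i ↦ (hg i).trans (hm₀ i).le

/-! ## §2 Integrability of exponentials of loop counts at a fixed mesh -/

/-- At a fixed mesh every exponential of a count of loops meeting a fixed ball is integrable (both
lattices; the count is measurable and uniformly bounded). -/
theorem integrable_exp_mul_ncard : ∀ E ∈ latticeEnsembles, ∀ {δ : ℝ}, 0 < δ → ∀ (ρ l : ℝ)
    (Q : UnbasedLoop ℂ → Prop), (∀ u, Q u → (u.range ∩ closedBall (0 : ℂ) ρ).Nonempty) →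
    Integrable (fun ω ↦ Real.exp (l * ({u ∈ (E.X δ ω).loops | Q u}.ncard : ℝ))) E.P := by
  intro E hE δ hδ ρ l Q hQ
  haveI := isProbabilityMeasure_of_mem hE
  obtain ⟨N, hN⟩ := FirstMoment.exists_ncard_loops_meeting_le E hE hδ ρ
  have hmeas : Measurable fun ω ↦ ({u ∈ (E.X δ ω).loops | Q u}.ncard : ℝ) :=
    measurable_from_nat.comp (BigLoops.measurable_ncard_loops_sep E hE δ Q)
  refine Integrable.of_bound (Real.measurable_exp.comp (hmeas.const_mul l)).aestronglyMeasurable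
    (Real.exp (|l| * N)) (Eventually.of_forall fun ω ↦ ?_)
  rw [Real.norm_eq_abs, Real.abs_exp]
  refine Real.exp_le_exp.2 ?_
  have hsub : {u ∈ (E.X δ ω).loops | Q u} ⊆
      {u ∈ (E.X δ ω).loops | (u.range ∩ closedBall (0 : ℂ) ρ).Nonempty} := fun u hu ↦ ⟨hu.1, hQ u hu.2⟩
  have h1 : ({u ∈ (E.X δ ω).loops | Q u}.ncard : ℝ) ≤ N := by
    exact_mod_cast (Set.ncard_le_ncard hsub (hN ω).1).trans (hN ω).2
  have h2 : (0 : ℝ) ≤ ({u ∈ (E.X δ ω).loops | Q u}.ncard : ℝ) := Nat.cast_nonneg _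
  calc l * ({u ∈ (E.X δ ω).loops | Q u}.ncard : ℝ) ≤ |l| * ({u ∈ (E.X δ ω).loops | Q u}.ncard : ℝ) :=
        mul_le_mul_of_nonneg_right (le_abs_self l) h2
    _ ≤ |l| * N := mul_le_mul_of_nonneg_left h1 (abs_nonneg l)

/-! ## §3 The bound on bond-`ℤ²` -/

/-- **Aspect-dependent exponential moments of a collar crossing count, bond-`ℤ²`** (with the
exponent `α` and mesh threshold `c₁` of `annulusOpenCrossing_half_le_holds`; `c₀ = max c₁ 4`). -/
theorem expMoment_collarCount_le_zEns_of {α c₁ : ℝ} (hα : 0 < α)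
    (hbd : ∀ (x : ℂ) (δ r R : ℝ), 0 < δ → c₁ * δ ≤ r → 2 * r ≤ R →
      (bondPercolation (zdGraph 2) half).real (annulusOpenCrossing x δ r R) ≤ (r / R) ^ α)
    {K : ℝ} (hK : 8 ≤ K) {δ ρ a l : ℝ} (hδ : 0 < δ) (hc₁ : c₁ * δ ≤ a) (h4 : 4 * δ ≤ a) (hρ : 0 < ρ)
    (hl : 0 ≤ l) (hq : Real.exp (2 * l) * (4 / K) ^ α ≤ 1 / 2) (Q : UnbasedLoop ℂ → Prop)
    (hQ : ∀ u, Q u → (∃ z ∈ u.range, ρ - a / 2 ≤ ‖z‖ ∧ ‖z‖ ≤ ρ) ∧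
      ∀ x : ℂ, ‖x‖ = ρ → (u.range ∩ (ball x (K * a))ᶜ).Nonempty) :
    Integrable (fun ω ↦ Real.exp (l * ({u ∈ (zEns.X δ ω).loops | Q u}.ncard : ℝ))) zEns.P ∧
    ∫ ω, Real.exp (l * ({u ∈ (zEns.X δ ω).loops | Q u}.ncard : ℝ)) ∂zEns.P ≤
      Real.exp (2 * (Real.exp (2 * l) - 1) * (4 / K) ^ α * (4 * π * ρ / a + 3)) := by
  haveI := isProbabilityMeasure_of_mem zEns_mem
  have ha : 0 < a := by linarith
  have hQρ : ∀ u, Q u → (u.range ∩ closedBall (0 : ℂ) ρ).Nonempty := fun u hu ↦ by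
    obtain ⟨z, hz, -, hz2⟩ := (hQ u hu).1
    exact ⟨z, hz, mem_closedBall_zero_iff.2 hz2⟩
  refine ⟨integrable_exp_mul_ncard zEns zEns_mem hδ ρ l Q hQρ, ?_⟩
  -- the cells
  obtain ⟨B, c, hB, hcn, hc⟩ := exists_circle_cells hρ ha
  have hab : a + 2 * δ ≤ K * a := by nlinarith
  obtain ⟨M, hM⟩ := FirstMoment.exists_ncard_loops_meeting_le zEns zEns_mem hδ ρ
  -- the single-cell crossing probability
  set p : ℝ := (4 / K) ^ α with hp
  have hp0 : 0 ≤ p := by positivity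
  have hpc : ∀ x : ℂ, (bondPercolation (zdGraph 2) half).real
      (annulusOpenCrossing x δ (a + δ) (K * a - δ)) ≤ p := fun x ↦
    TowerMomentUpper.crossing_le_zEns hα hbd hK hδ hc₁ (by linarith) x
  -- the pattern events
  set EV₁ : (Fin B → ℕ) → Set (BondConfig (Site 2)) := fun g ↦
    (List.ofFn fun i ↦ disjointOccurrencePow (annulusOpenCrossing (c i) δ (a + δ) (K * a - δ))
      (g i)).foldr disjointOccurrence univ with hEV₁
  set EV₀ : (Fin B → ℕ) → Set (BondConfig (Site 2)) := fun g ↦ dualConfig ⁻¹'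
    (List.ofFn fun i ↦ disjointOccurrencePow
      (annulusOpenCrossing (c i - δ * (1 + Complex.I) / 2) δ (a + δ) (K * a - δ)) (g i)).foldr
        disjointOccurrence univ with hEV₀
  have h₁ : ∀ g, MeasurableSet (EV₁ g) ∧ zEns.P.real (EV₁ g) ≤ ∏ i, p ^ (g i) := fun g ↦
    TowerMomentUpper.pattern_bound_zEns hδ c (fun _ ↦ a + δ) (fun _ ↦ K * a - δ) (fun i ↦ hpc (c i)) g
  have h₀ : ∀ g, MeasurableSet (EV₀ g) ∧ zEns.P.real (EV₀ g) ≤ ∏ i, p ^ (g i) := by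
    intro g
    obtain ⟨hmeas, hle⟩ := TowerMomentUpper.pattern_bound_zEns hδ
      (fun i ↦ c i - δ * (1 + Complex.I) / 2) (fun _ ↦ a + δ) (fun _ ↦ K * a - δ) (fun i ↦ hpc _) g
    exact ⟨measurableSet_preimage measurable_dualConfig hmeas,
      (ENNReal.toReal_mono (measure_ne_top _ _)
        (SSContinuity.measure_preimage_dualConfig_le _)).trans hle⟩
  have key := integral_exp_le_of_poissonTails zEns.P hl hp0 hq EV₁ EV₀ (fun g ↦ (h₁ g).1)
    (fun g ↦ (h₀ g).1) (fun g ↦ (h₁ g).2) (fun g ↦ (h₀ g).2) (M := M)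
    (fun ω ↦ {u ∈ (zEns.X δ ω).loops | Q u}.ncard) ?_
  · refine key.trans (Real.exp_le_exp.2 (mul_le_mul_of_nonneg_left hB ?_))
    have : 0 ≤ Real.exp (2 * l) - 1 := by linarith [Real.one_le_exp (by positivity : 0 ≤ 2 * l)]
    positivity
  · change ∀ᵐ ω ∂(bondPercolation (zdGraph 2) half), _
    filter_upwards [ae_subset_edgeSet (zdGraph 2) half] with ω hω
    obtain ⟨m₀, m₁, hN, h1, h0⟩ := exists_collarPatterns_zEns hω hδ hρ hab (hM ω) hcn hc Q hQ
    exact ⟨fun i ↦ (m₁ i : ℕ), fun i ↦ (m₀ i : ℕ), fun i ↦ Nat.lt_succ_iff.1 (m₁ i).2,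
      fun i ↦ Nat.lt_succ_iff.1 (m₀ i).2, h1, h0, hN⟩

end UVCollar

/-! ## Anchor: the bond-`ℤ²` half in registered form -/

/-- **Anchor (helper toward K `uvCollar_expMoment_latticeEnsembles`): aspect-dependent, Poissonian
exponential moments of the number of loops crossing a thin collar, bond-`ℤ²`.**  There are
`α, c₀ > 0`, `c₀ ≥ 4`, such that for every aspect ratio `K ≥ 8`, mesh `δ > 0`, radius `ρ > 0`, cell
size `a ≥ c₀ δ`, order `λ ≥ 0` with `e^{2λ}(4/K)^α ≤ 1/2`, and every family `Q` of loops each passing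
through the collar `ρ − a/2 ≤ |z| ≤ ρ` and not inside any `B(x, Ka)` with `|x| = ρ`:
`E_δ exp(λ #{u ∈ X_δ : Q u}) ≤ exp(2 (e^{2λ} − 1) (4/K)^α (4πρ/a + 3))` (integrability included). -/
theorem expMoment_collarCount_le_zEns : ∃ α c₀ : ℝ, 0 < α ∧ 4 ≤ c₀ ∧ ∀ (K δ ρ a l : ℝ) (Q : UnbasedLoop ℂ → Prop), 8 ≤ K → 0 < δ → c₀ * δ ≤ a → 0 < ρ → 0 ≤ l → Real.exp (2 * l) * (4 / K) ^ α ≤ 1 / 2 → (∀ u, Q u → (∃ z ∈ u.range, ρ - a / 2 ≤ ‖z‖ ∧ ‖z‖ ≤ ρ) ∧ ∀ x : ℂ, ‖x‖ = ρ → (u.range ∩ (Metric.ball x (K * a))ᶜ).Nonempty) → Integrable (fun ω ↦ Real.exp (l * ({u ∈ (zEns.X δ ω).loops | Q u}.ncard : ℝ))) zEns.P ∧ ∫ ω, Real.exp (l * ({u ∈ (zEns.X δ ω).loops | Q u}.ncard : ℝ)) ∂zEns.P ≤ Real.exp (2 * (Real.exp (2 * l) - 1) * (4 / K) ^ α * (4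 * π * ρ / a + 3)) := by
  obtain ⟨α, c₁, hα, hc₁, hbd⟩ := annulusOpenCrossing_half_le_holds
  refine ⟨α, max c₁ 4, hα, le_max_right _ _, fun K δ ρ a l Q hK hδ ha hρ hl hq hQ ↦ ?_⟩
  have hc₁a : c₁ * δ ≤ a := le_trans (mul_le_mul_of_nonneg_right (le_max_left _ _) hδ.le) ha
  have h4 : 4 * δ ≤ a := le_trans (mul_le_mul_of_nonneg_right (le_max_right _ _) hδ.le) ha
  exact UVCollar.expMoment_collarCount_le_zEns_of hα hbd hK hδ hc₁a h4 hρ hl hq Q hQ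

end Summit.CriticalPhenomena.CardyFormulaZ2.Cruxes.NestingRigidity.PositiveConeWeightDoubling

end
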